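import Mathlib
import Summits.ResolutionOfSingularities.ResolutionOfSingularities.Theorems.RadicialJungCleanModelsContactChainRestart
import Summits.ResolutionOfSingularities.ResolutionOfSingularities.Theorems.RadicialJungCleanModelsCleanLU3Abhyankar
import Summits.ResolutionOfSingularities.ResolutionOfSingularities.Theorems.RadicialJungCleanModelsCcurveUnitDichotomy
import Literature.AlgebraicGeometry.Resolution.CompleteLocalDomainNormalization
import HarnessLib

/-!
# Route `RadicialJung`, crux `CleanModels` (stmt-ResolutionOfSingularities-15917), line `Sketch` rev 35, stub 6 `stub_cleanProp44` (X44c),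
# work plan O8 / L7b: (T1-core) — a GOOD `p`-th-power approximation exists as soon as the curve's local ring is a DEFECTLESS discrete valuation ring

Memo `Cruxes/CleanModels/Lines/Sketch-memo-hand2-g8-stubs-5-7.md` §2 (T1-core).  `A` regular local of dimension `3` and characteristic `p`, `P = (t₁,t₂)` the
ideal of a regular curve, `w` transversal (`P + (w) = 𝔪`), so `D := A/P` is a discrete valuation ring with uniformizer `w̄`; `v ∈ A` with `v̄ ∉ D^p`.
If the valued field `(Frac D, D)` is DEFECTLESS (`IsDefectlessField`, Kuhlmann; e.g. `D` excellent), then `v̄` has a best `p`-th-power approximation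
(✓ `exists_isMin_pthPowerApprox_of_isDefectlessField`), which is a GOOD one (✓ `Ccurve.dichotomy_of_best_approx`); lifted to `A`:
`v − c^p = γ₀ w^{k'} + s₀₀` with `γ₀` a unit, `s₀₀ ∈ P`, and `p ∤ k'` or the residue of `γ₀` not a `p`-th power.

* `span_singleton_eq_maximalIdeal_quotient` — `𝔪_{A/P} = (w̄)`.
* `exists_goodApprox_of_isDefectlessField` — the statement above.
* `exists_pointChain_cleanPermissibleAt_of_isDefectlessField` — **L7b exit for the all-transversal uncharged configuration, modulo defectlessness of
  `𝒪_{C₀,x₀}`**: with ✓ `cleanPermissibleAt_of_pointChain_uncharged_of_residue` (`k' = 0`) and ✓ `exists_pointChain_cleanPermissibleAt_of_goodApprox`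
  (`k' ≥ 1`).  What then remains of (T1): «`𝒪_{C₀,x₀}` excellent ⟹ `IsDefectlessField`» (Kuhlmann 2010 §1; Bourbaki AC IX) and the case
  `v̄ ∈ D^p` (the memo's (T2)).

Honest framing: OURS (elementary given the tree's Kuhlmann lemmas); nothing here proves resolution in characteristic `p`, X44c, or any case of
`CleanModels`.
-/

noncomputable section

set_option linter.dupNamespace false -- mandated namespace of this single-conjunct summit

open CategoryTheory AlgebraicGeometry TopologicalSpace IsLocalRing
open Literature.AlgebraicGeometry.Resolution Literature.AlgebraicGeometry.Motives
open Scheme.IdealSheafData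

namespace Summit.ResolutionOfSingularities.ResolutionOfSingularities.Theorems.RadicialJung.CleanModels

/-- In a regular local ring of dimension one, a one-element part of a regular system of parameters generates the maximal ideal; applied to
`w̄ ∈ A/P` when `P + (w) = 𝔪` and `dim A/P = 1`. [cite: Matsumura1987, Thm. 14.2] -/
theorem span_singleton_eq_maximalIdeal_quotient {A : Type} [CommRing A] [IsLocalRing A] (P : Ideal A) [IsRegularLocalRing (A ⧸ P)]
    (hP1 : ringKrullDim (A ⧸ P) = 1) (w : A) (hw : P ⊔ Ideal.span {w} = maximalIdeal A) :
    maximalIdeal (A ⧸ P) = Ideal.span {Ideal.Quotient.mk P w} := by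
  have hb := isRsopPart_quotient_singleton_of_sup_span_eq P hP1 w hw
  obtain ⟨_, e, y, hdim, hspan⟩ := hb
  rw [hP1] at hdim
  have he : e = 0 := by
    have : (1 : WithBot ℕ∞) = ((1 + e : ℕ) : WithBot ℕ∞) := hdim
    have h' : (1 : ℕ) = 1 + e := by exact_mod_cast this
    omega
  subst he
  rw [← hspan, Set.range_eq_empty y, Set.union_empty]
  congr 1
  ext z
  simp only [Set.mem_range, Function.comp_apply, Set.mem_singleton_iff]
  constructor
  · rintro ⟨i, rfl⟩; fin_cases i; rfl
  · rintro rfl; exact ⟨0, rfl⟩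

/-- **A good `p`-th-power approximation from defectlessness.**  See the module docstring. [cite: Kuhlmann2010, Section 1 (p. 3)]
[cite: Matsumura1987, Thm. 14.2] -/
theorem exists_goodApprox_of_isDefectlessField {A : Type} [CommRing A] [IsRegularLocalRing A] (p : ℕ) [hp : Fact p.Prime] [CharP A p]
    (P : Ideal A) [P.IsPrime] (t : Fin 2 → A) (ht : IsRsopPart t) (htP : Ideal.span (Set.range t) = P) (h3 : ringKrullDim A = 3)
    (w : A) (hw : P ⊔ Ideal.span {w} = maximalIdeal A) (v : A) (hv : ∀ c : A, v - c ^ p ∉ P)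
    (hdef : ∀ W : ValuationSubring (FractionRing (A ⧸ P)),
      (∀ x, x ∈ W ↔ ∃ a : A ⧸ P, algebraMap (A ⧸ P) (FractionRing (A ⧸ P)) a = x) → IsDefectlessField (FractionRing (A ⧸ P)) W) :
    ∃ (c γ₀ s₀₀ : A) (k' : ℕ), IsUnit γ₀ ∧ s₀₀ ∈ P ∧ v - c ^ p = γ₀ * w ^ k' + s₀₀ ∧
      (¬ p ∣ k' ∨ ∀ c₁ : A, γ₀ - c₁ ^ p ∉ maximalIdeal A) := by
  classical
  -- the discrete valuation ring `D = A/P`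
  haveI : IsRegularLocalRing (A ⧸ P) := by rw [← htP]; exact ht.isRegularLocalRing_quotient
  have hP1 : ringKrullDim (A ⧸ P) = 1 := by rw [← htP]; exact ringKrullDim_quotient_span_pair_eq_one ht h3
  haveI : IsDiscreteValuationRing (A ⧸ P) := isDiscreteValuationRing_of_isRegularLocalRing_of_ringKrullDim_eq_one (A ⧸ P) hP1
  set D := A ⧸ P
  set mk : A →+* D := Ideal.Quotient.mk P with hmk
  have hPm : P ≤ maximalIdeal A := le_sup_left.trans hw.le
  have hPtop : P ≠ ⊤ := fun h => (maximalIdeal.isMaximal A).ne_top (top_le_iff.mp (h ▸ hPm))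
  -- characteristic `p` passes to `D` and to its fraction field
  haveI : CharP D p := by
    refine CharP.quotient' p P fun x hx => ?_
    by_contra hne
    have hndvd : ¬ p ∣ x := fun hd => hne ((CharP.cast_eq_zero_iff A p x).mpr hd)
    -- `x` is invertible modulo `p`, hence `(x : A)` is a unit, contradicting `P ≠ ⊤`
    have hcop : Nat.Coprime x p := (Nat.coprime_comm.mp ((Nat.Prime.coprime_iff_not_dvd hp.out).mpr hndvd))
    obtain ⟨a, b, hab⟩ : ∃ a b : ℤ, a * x + b * p = 1 := by
      have := Nat.Coprime.isCoprime hcop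
      obtain ⟨a, b, h⟩ := this
      exact ⟨a, b, by linarith [h]⟩
    have hunit : IsUnit (x : A) := by
      refine IsUnit.of_mul_eq_one (a : A) ?_
      have h1 : ((a * x + b * p : ℤ) : A) = 1 := by rw [hab]; simp
      have hp0 : ((p : ℤ) : A) = 0 := by rw [Int.cast_natCast]; exact CharP.cast_eq_zero A p
      simp only [Int.cast_add, Int.cast_mul, Int.cast_natCast, hp0, mul_zero, add_zero] at h1
      rw [mul_comm]; exact h1
    exact hPtop (Ideal.eq_top_of_isUnit_mem P hx hunit)
  let K := FractionRing D
  haveI : CharP K p := charP_of_injective_algebraMap (IsFractionRing.injective D K) p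
  set W : ValuationSubring K := (ValuationRing.valuation D K).valuationSubring with hWdef
  have hWmem : ∀ x : K, x ∈ W ↔ ∃ a : D, algebraMap D K a = x := fun x => by
    rw [hWdef, Valuation.mem_valuationSubring_iff, ← Valuation.mem_integer_iff, ValuationRing.mem_integer_iff]
  -- the uniformizer `w̄`
  have hmax : maximalIdeal D = Ideal.span {mk w} := span_singleton_eq_maximalIdeal_quotient P hP1 w hw
  have hw0 : mk w ≠ 0 := by
    intro h0
    rw [h0, Ideal.span_singleton_zero] at hmax
    exact (IsDiscreteValuationRing.not_isField D) (IsLocalRing.isField_iff_maximalIdeal_eq.mpr hmax)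
  have hirr : Irreducible (mk w) := IsDiscreteValuationRing.irreducible_of_span_eq_maximalIdeal (mk w) hw0 hmax
  -- `v̄` is not a `p`-th power in `K`
  set g₀ : K := algebraMap D K (mk v) with hg₀def
  have hg₀W : g₀ ∈ W := (hWmem g₀).mpr ⟨mk v, rfl⟩
  have hg₀ : ∀ c : K, c ^ p ≠ g₀ := by
    intro c hc
    have hint : IsIntegral D c := IsIntegral.of_pow hp.out.pos (by rw [hc]; exact isIntegral_algebraMap)
    obtain ⟨a, ha⟩ := IsIntegrallyClosed.isIntegral_iff.mp hint
    obtain ⟨ã, hã⟩ := Ideal.Quotient.mk_surjective a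
    have : mk v = a ^ p := IsFractionRing.injective D K (by rw [map_pow, ha, hc])
    apply hv ã
    rw [← Ideal.Quotient.eq_zero_iff_mem, map_sub, map_pow]
    change mk v - mk ã ^ p = 0
    rw [hã, this, sub_self]
  -- best approximation (defectlessness), inside `W`, and its dichotomy
  obtain ⟨f₀, hbest⟩ := exists_isMin_pthPowerApprox_of_isDefectlessField W (hdef W hWmem) g₀ hg₀
  have hf₀W : f₀ ∈ W := Ccurve.best_approx_mem p W hg₀W hbest
  obtain ⟨a₀, ha₀⟩ := (hWmem f₀).mp hf₀W
  have hd0 : mk v - a₀ ^ p ≠ 0 := by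
    intro h0
    apply hg₀ f₀
    have : algebraMap D K (a₀ ^ p) = algebraMap D K (mk v) := by rw [(sub_eq_zero.mp h0)]
    rw [map_pow, ha₀] at this
    exact this
  obtain ⟨m, u, hum⟩ := IsDiscreteValuationRing.eq_unit_mul_pow_irreducible hd0 hirr
  set z : K := algebraMap D K (mk w) with hzdef
  have hz0 : z ≠ 0 := fun h => hw0 (IsFractionRing.injective D K (by rw [map_zero]; exact h))
  set U : K := algebraMap D K (u : D) with hUdef
  have hUW : U ∈ W := (hWmem U).mpr ⟨u, rfl⟩
  have hUinvW : U⁻¹ ∈ W := (hWmem _).mpr ⟨((u⁻¹ : Dˣ) : D), by rw [hUdef]; exact map_units_inv (algebraMap D K) u⟩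
  have hU : W.valuation U = 1 := by
    have hunit : IsUnit (⟨U, hUW⟩ : W) :=
      IsUnit.of_mul_eq_one ⟨U⁻¹, hUinvW⟩ (Subtype.ext (by
        change U * U⁻¹ = 1
        exact mul_inv_cancel₀ (fun h => by
          have : (u : D) = 0 := IsFractionRing.injective D K (by rw [map_zero]; exact h)
          exact u.ne_zero this)))
    exact (W.valuation_eq_one_iff _).mp hunit
  have hδ : g₀ - f₀ ^ p = z ^ m * U := by
    rw [hg₀def, ← ha₀, ← map_pow, ← map_sub, hum, map_mul, map_pow, hzdef, hUdef, mul_comm]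
  have hdich := Ccurve.dichotomy_of_best_approx p W hz0 hUW hU hδ hbest
  -- lift to `A`
  obtain ⟨c, hc⟩ := Ideal.Quotient.mk_surjective a₀
  obtain ⟨γ₀, hγ₀⟩ := Ideal.Quotient.mk_surjective (u : D)
  have hγ₀unit : IsUnit γ₀ := by
    by_contra hnu
    have hmem : γ₀ ∈ maximalIdeal A := (mem_maximalIdeal _).mpr hnu
    have : mk γ₀ ∈ maximalIdeal D := by
      rw [← map_maximalIdeal_of_surjective mk Ideal.Quotient.mk_surjective]
      exact Ideal.mem_map_of_mem _ hmem
    rw [hγ₀] at this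
    exact (mem_maximalIdeal _).mp this u.isUnit
  refine ⟨c, γ₀, v - c ^ p - γ₀ * w ^ m, m, hγ₀unit, ?_, by ring, ?_⟩
  · rw [← Ideal.Quotient.eq_zero_iff_mem]
    change mk (v - c ^ p - γ₀ * w ^ m) = 0
    rw [map_sub, map_sub, map_pow, map_mul, map_pow, hc, hγ₀, hum]
    ring
  · rcases hdich with hndvd | hres
    · exact Or.inl hndvd
    · refine Or.inr fun c₁ hc₁ => ?_
      have he : algebraMap D K (mk c₁) ∈ W := (hWmem _).mpr ⟨mk c₁, rfl⟩
      have h1 := hres _ he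
      -- `U - e^p = algebraMap (mk (γ₀ - c₁^p))` has valuation `1`, so `mk (γ₀ - c₁^p)` is a unit of `D`
      have hval : W.valuation (algebraMap D K (mk (γ₀ - c₁ ^ p))) = 1 := by
        rw [map_sub, map_pow, hγ₀, map_sub, map_pow]
        exact h1
      have hmemW : algebraMap D K (mk (γ₀ - c₁ ^ p)) ∈ W := (hWmem _).mpr ⟨_, rfl⟩
      have hunitW : IsUnit (⟨algebraMap D K (mk (γ₀ - c₁ ^ p)), hmemW⟩ : W) := (W.valuation_eq_one_iff _).mpr hval
      -- a unit of `W` which is the image of `d ∈ D` gives a unit `d`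
      obtain ⟨inv, hinv⟩ := hunitW.exists_right_inv
      obtain ⟨b, hb⟩ := (hWmem (inv : K)).mp inv.2
      have hprod : mk (γ₀ - c₁ ^ p) * b = 1 := by
        apply IsFractionRing.injective D K
        rw [map_mul, hb, map_one]
        exact congrArg Subtype.val hinv
      have hdunit : IsUnit (mk (γ₀ - c₁ ^ p)) := IsUnit.of_mul_eq_one _ hprod
      have : mk (γ₀ - c₁ ^ p) ∈ maximalIdeal D := by
        rw [← map_maximalIdeal_of_surjective mk Ideal.Quotient.mk_surjective]
        exact Ideal.mem_map_of_mem _ hc₁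
      exact (mem_maximalIdeal _).mp this hdunit

/-- The curve ideal at a point of a regular curve is prime (it is generated by part of a regular system of parameters). [cite: Matsumura1987, Thm. 14.2] -/
theorem isPrime_stalkIdeal_of_rsopPair {X₀ : Scheme.{0}} {C₀ : Closeds X₀} {x₀ : X₀} {c : Fin 2 → X₀.presheaf.stalk x₀}
    (hc : IsRsopPart c) (hcP : Ideal.span (Set.range c) = stalkIdeal (vanishingIdeal C₀) x₀) :
    (stalkIdeal (vanishingIdeal C₀) x₀).IsPrime := by
  rw [← hcP]; exact hc.isPrime_span_range

/-- **L7b exit for the all-transversal uncharged configuration, modulo defectlessness of `𝒪_{C₀,x₀}`.**  See the module docstring; the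
primality instance `hP` is `isPrime_stalkIdeal_of_rsopPair`. [cite: Kuhlmann2010, Section 1 (p. 3)]
[cite: CossartJannsenSaito2020, proof of Thm. 6.28, Step 5] -/
theorem exists_pointChain_cleanPermissibleAt_of_isDefectlessField {X₀ : Scheme.{0}} [IsIntegral X₀] [IsLocallyNoetherian X₀]
    (hX₀ : Scheme.IsRegular X₀) (p : ℕ) [Fact p.Prime] [CharP X₀.functionField p] {C₀ : Closeds X₀}
    (hC₀reg : ∀ y ∈ (C₀ : Set X₀), ∃ c : Fin 2 → X₀.presheaf.stalk y,
      IsRsopPart c ∧ Ideal.span (Set.range c) = stalkIdeal (vanishingIdeal C₀) y)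
    {x₀ : X₀} (hx₀ : IsClosed ({x₀} : Set X₀)) (hx₀C : x₀ ∈ (C₀ : Set X₀)) (hdim₀ : ringKrullDim (X₀.presheaf.stalk x₀) = 3)
    [hP : (stalkIdeal (vanishingIdeal C₀) x₀).IsPrime]
    (G : X₀.functionField) (cc : Fin p → X₀.functionField) (hcc : ∃ j : Fin p, (j : ℕ) ≠ 0 ∧ cc j ≠ 0)
    (w u₀ : X₀.presheaf.stalk x₀) (hw : stalkIdeal (vanishingIdeal C₀) x₀ ⊔ Ideal.span {w} = maximalIdeal _) (hu₀ : IsUnit u₀)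
    {m : ℕ} (γ s₀ : Fin m → X₀.presheaf.stalk x₀) (hγ : ∀ i, IsUnit (γ i))
    (hs₀ : ∀ i, s₀ i ∈ stalkIdeal (vanishingIdeal C₀) x₀) (k a : Fin m → ℕ) {N' : ℕ} (hN : ∑ i, k i * a i = N' * p)
    (hX : (∑ j : Fin p, cc j ^ p * G ^ (j : ℕ)) = RatFn.toFunctionField x₀ (u₀ * ∏ i, (γ i * w ^ k i + s₀ i) ^ a i))
    (hv : ∀ c : X₀.presheaf.stalk x₀, u₀ * ∏ i, γ i ^ a i - c ^ p ∉ stalkIdeal (vanishingIdeal C₀) x₀)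
    (hdef : ∀ W : ValuationSubring (FractionRing (X₀.presheaf.stalk x₀ ⧸ stalkIdeal (vanishingIdeal C₀) x₀)),
      (∀ x, x ∈ W ↔ ∃ d : X₀.presheaf.stalk x₀ ⧸ stalkIdeal (vanishingIdeal C₀) x₀,
        algebraMap _ (FractionRing (X₀.presheaf.stalk x₀ ⧸ stalkIdeal (vanishingIdeal C₀) x₀)) d = x) →
      IsDefectlessField (FractionRing (X₀.presheaf.stalk x₀ ⧸ stalkIdeal (vanishingIdeal C₀) x₀)) W) :
    ∃ (X : Scheme.{0}) (_ : IsIntegral X) (_ : IsLocallyNoetherian X) (σ : X ⟶ X₀) (_ : IsDominant σ) (C : Closeds X) (x : X) (n : ℕ),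
      IsPointChainAlong σ C₀ C x n ∧ σ x = x₀ ∧ IsClosed ({x} : Set X) ∧
      CleanPermissibleAt p (RatFn.toFunctionField x) (RatFn.functionFieldMap σ G) (stalkIdeal (vanishingIdeal C) x) := by
  classical
  haveI : IsRegularLocalRing (X₀.presheaf.stalk x₀) := hX₀ x₀
  haveI : CharP (X₀.presheaf.stalk x₀) p := (RatFn.toFunctionField x₀).charP (RatFn.toFunctionField_injective x₀) p
  obtain ⟨c2, hc2, hc2P⟩ := hC₀reg x₀ hx₀C
  obtain ⟨c, γ₀, s₀₀, k', hγ₀, hs₀₀, hvc, hgood⟩ :=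
    exists_goodApprox_of_isDefectlessField p (stalkIdeal (vanishingIdeal C₀) x₀) c2 hc2 hc2P hdim₀ w hw (u₀ * ∏ i, γ i ^ a i) hv hdef
  by_cases hk' : k' = 0
  · -- the residue of `v` itself is not a `p`-th power: exit at the first landing
    subst hk'
    have hres0 : ∀ c₁ : X₀.presheaf.stalk x₀, γ₀ - c₁ ^ p ∉ maximalIdeal _ := hgood.resolve_left (by simp)
    have hPm : stalkIdeal (vanishingIdeal C₀) x₀ ≤ maximalIdeal _ := le_sup_left.trans hw.le
    rw [pow_zero, mul_one] at hvc
    have hres : ∀ c' : X₀.presheaf.stalk x₀, u₀ * ∏ i, γ i ^ a i - c' ^ p ∉ maximalIdeal _ := by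
      intro c' hc'
      apply hres0 (c' - c)
      have : γ₀ - (c' - c) ^ p = (u₀ * ∏ i, γ i ^ a i - c' ^ p) - s₀₀ := by
        rw [sub_pow_char]
        linear_combination (-1 : X₀.presheaf.stalk x₀) * hvc
      rw [this]
      exact Ideal.sub_mem _ hc' (hPm hs₀₀)
    obtain ⟨X, hXi, hXn, σ, hσ, C, x, h, hσx, hxcl⟩ := exists_pointChainAlong_isDominant hX₀ hC₀reg hx₀ hx₀C hdim₀ (Finset.univ.sup k)
    subst hσx
    refine ⟨X, hXi, hXn, σ, hσ, C, x, _, h, rfl, hxcl, ?_⟩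
    exact cleanPermissibleAt_of_pointChain_uncharged_of_residue h hX₀ hC₀reg hx₀C hdim₀ p G cc hcc w u₀ hw hu₀ γ s₀ hγ hs₀ k a
      (fun i => Finset.le_sup (Finset.mem_univ i)) (by rw [hN]; exact dvd_mul_left p N') hres hX
  · exact exists_pointChain_cleanPermissibleAt_of_goodApprox hX₀ p hC₀reg hx₀ hx₀C hdim₀ G cc hcc w u₀ hw γ s₀ hs₀ k a hN hX c γ₀ s₀₀ k'
      (Nat.one_le_iff_ne_zero.mpr hk') hγ₀ hs₀₀ hvc hgood

end Summit.ResolutionOfSingularities.ResolutionOfSingularities.Theorems.RadicialJung.CleanModels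

end
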